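import Summits.Ventures.HodgeRepro.Tier3WeilLineKunneth

/-!
# The diagonal operators are multilinear on the Künneth component — §3's «`K` is a module over `R = F^{⊗ 2p}`»

Blind re-derivation cell `pub-hodge-repro`, seat `t3-p4` (Tier 3, T3.5 for T3.4 = Lemma R).  Target tree path
`lean/Summits/Ventures/HodgeRepro/Tier3KunnethDiagonal.lean`; imports the cell's `Tier3WeilLineKunneth`.

WHAT THIS FILE STATES (LEMMA-R-RESIDUE.md §3, last sentence: «on the Künneth component `K := ⊗_i H¹(A_{T_i}, ℚ) ⊂
H^{2p}(B, ℚ)` [the product endomorphism `α(a_1, …, a_{2p})^*`] acts as `⊗_i ι_i(a_i)^*` …, ADDITIVELY in each `a_i`.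
Hence `K` is a module over the `ℚ`-algebra `R := F^{⊗ 2p} = F ⊗_ℚ ⋯ ⊗_ℚ F` (`a_1 ⊗ ⋯ ⊗ a_{2p} ↦ ⊗_i ι_i(a_i)^*`)»).
On the kernel the product endomorphism is the diagonal operator `A′ b = (ω′ᵢ ↦ bᵢ • ω′ᵢ)`, `b : ι → K`, acting on
`⋀[F₀]^n V` as `⋀^n(A′ b)` (§15, `Tier3LemmaRGenerator` / `Tier3LemmaRCorrespondence`), and the Künneth component is the
`F₀`-span of the wedges with exactly one vector from each corner line `K · ω′ᵢ` (`Tier3WeilLineKunneth`).  The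
`R`-module structure is the statement that `b ↦ ⋀^n(A′ b)|_K` is `F₀`-MULTILINEAR in `b` (additive, zero-preserving and
`F₀`-homogeneous in each coordinate `bᵢ`) and multiplicative (`⋀^n(A′ b) ∘ ⋀^n(A′ b′) = ⋀^n(A′ (b * b′))`, already on the
kernel: `Tier3ProjectorCorrespondence.diag_comp_diag` + `exteriorPower.map_comp`):

* `diag_map_ιMulti_kunneth` — on a Künneth wedge `∧_t c_t ω′_{e t}`, `⋀^n(A′ b)` scales the slot `t` by `b (e t)`:
  `⋀^n(A′ b) (∧_t c_t ω′_{e t}) = ∧_t (b (e t) c_t) ω′_{e t}` — «acts as `⊗_i ι_i(a_i)^*`»;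
* `diag_update_kunneth_family` — changing the coordinate `i` of `b` changes exactly the slot `t₀` with `e t₀ = i`;
* `diag_map_update_add_of_mem_kunneth` / `diag_map_update_zero_of_mem_kunneth` /
  `diag_map_update_smul_of_mem_kunneth` — **«additively in each `a_i`»**: for `w` in the Künneth component,
  `⋀^n(A′ (b with a + a′ at i)) w = ⋀^n(A′ (b with a at i)) w + ⋀^n(A′ (b with a′ at i)) w`,
  `⋀^n(A′ (b with 0 at i)) w = 0`, and `⋀^n(A′ (b with r • a at i)) w = r • ⋀^n(A′ (b with a at i)) w` for `r ∈ F₀`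
  (`AlternatingMap.map_update_add` / `map_update_zero` / `map_update_smul` in that slot, then the span).

§4(d)'s `act(a) = ⋀^n(A′ (a at i₀, 1 elsewhere))` is the case `b = 1` of the coordinate `i₀`
(`Tier3WeilLineKunneth.weil_act_add_of_mem_kunneth`).  HONESTY.  Off the Künneth component `⋀^n(A′ b)` is NOT
multilinear in `b` (on a wedge with two vectors of one corner it has degree two in that coordinate —
`Tier3WeilLineModule`'s HONESTY paragraph), which is why §3 restricts to `K`; the `R`-module structure itself
(`R = K^{⊗_{F₀} n}` acting through its universal property) is not built — the file states the multilinear law that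
defines it, with no definition, instance or notation.  Nothing mathematical moves (residue 0 unchanged); linear algebra on
the cell's own modules and Mathlib.  HC_CM is NOT proved by anyone in this repository.
-/

set_option autoImplicit false

open TensorProduct Finset

namespace HodgeRepro.Tier3

open HodgeRepro.RouteC

section DiagonalOnKunneth

variable {F₀ K : Type*} [Field F₀] [Field K] [Algebra F₀ K]
variable {V : Type*} [AddCommGroup V] [Module K V] [Module F₀ V] [IsScalarTower F₀ K V]
variable {ι : Type*} [DecidableEq ι]

omit [DecidableEq ι] in
/-- **On a Künneth wedge the diagonal operator scales each slot by its corner's coordinate**: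
`⋀^n(A′ b) (∧_t c_t ω′_{e t}) = ∧_t (b (e t) · c_t) ω′_{e t}` — §3's «acts as `⊗_i ι_i(a_i)^*`». -/
theorem diag_map_ιMulti_kunneth (n : ℕ) (ω' : Module.Basis ι K V) (b : ι → K) (c : Fin n → K) (e : Fin n → ι) :
    exteriorPower.map n ((ω'.constr K fun i => b i • ω' i).restrictScalars F₀)
        (exteriorPower.ιMulti F₀ n (fun t => c t • ω' (e t))) =
      exteriorPower.ιMulti F₀ n (fun t => (b (e t) * c t) • ω' (e t)) := by
  rw [exteriorPower.map_apply_ιMulti]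
  congr 1
  funext t
  simp only [Function.comp_apply, LinearMap.coe_restrictScalars, map_smul, Module.Basis.constr_basis]
  rw [smul_smul, mul_comm]

/-- **Changing the coordinate `i` of `b` changes exactly the slot of the corner `i`**: for `e` injective with `e t₀ = i`,
the family `t ↦ ((b with a at i) (e t) · c_t) ω′_{e t}` is `update (t ↦ (b (e t) · c_t) ω′_{e t}) t₀ ((a · c_{t₀}) ω′ᵢ)`. -/
theorem diag_update_kunneth_family (ω' : Module.Basis ι K V) {n : ℕ} (b : ι → K) (i : ι) (a : K)
    (c : Fin n → K) (e : Fin n → ι) (he : Function.Injective e) (t₀ : Fin n) (ht₀ : e t₀ = i) :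
    (fun t => (Function.update b i a (e t) * c t) • ω' (e t)) =
      Function.update (fun t => (b (e t) * c t) • ω' (e t)) t₀ ((a * c t₀) • ω' i) := by
  funext t
  by_cases ht : t = t₀
  · subst ht
    rw [Function.update_self, ht₀, Function.update_self]
  · have hne : e t ≠ i := fun h => ht (he (h.trans ht₀.symm))
    rw [Function.update_of_ne ht, Function.update_of_ne hne]

/-- **«additively in each `a_i`»**: on the Künneth component, `⋀^n(A′ (b with a + a′ at i)) w =
⋀^n(A′ (b with a at i)) w + ⋀^n(A′ (b with a′ at i)) w` — on a Künneth wedge the slot of the corner `i` carries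
`((a + a′) c_{t₀}) ω′ᵢ = (a c_{t₀}) ω′ᵢ + (a′ c_{t₀}) ω′ᵢ` (`AlternatingMap.map_update_add`); the `F₀`-linear difference
vanishes on the generators, hence on the span. -/
theorem diag_map_update_add_of_mem_kunneth (n : ℕ) (ω' : Module.Basis ι K V) (b : ι → K) (i : ι) (a a' : K)
    (w : ⋀[F₀]^n V)
    (hw : w ∈ Submodule.span F₀ {w : ⋀[F₀]^n V | ∃ (c : Fin n → K) (e : Fin n → ι), Function.Bijective e ∧
      w = exteriorPower.ιMulti F₀ n (fun t => c t • ω' (e t))}) :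
    exteriorPower.map n ((ω'.constr K fun j => Function.update b i (a + a') j • ω' j).restrictScalars F₀) w =
      exteriorPower.map n ((ω'.constr K fun j => Function.update b i a j • ω' j).restrictScalars F₀) w +
      exteriorPower.map n ((ω'.constr K fun j => Function.update b i a' j • ω' j).restrictScalars F₀) w := by
  classical
  set D : ⋀[F₀]^n V →ₗ[F₀] ⋀[F₀]^n V :=
    exteriorPower.map n ((ω'.constr K fun j => Function.update b i (a + a') j • ω' j).restrictScalars F₀) -
      (exteriorPower.map n ((ω'.constr K fun j => Function.update b i a j • ω' j).restrictScalars F₀) +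
       exteriorPower.map n ((ω'.constr K fun j => Function.update b i a' j • ω' j).restrictScalars F₀)) with hD
  have hker : Submodule.span F₀ {w : ⋀[F₀]^n V | ∃ (c : Fin n → K) (e : Fin n → ι), Function.Bijective e ∧
      w = exteriorPower.ιMulti F₀ n (fun t => c t • ω' (e t))} ≤ LinearMap.ker D := by
    rw [Submodule.span_le]
    rintro _ ⟨c, e, hbij, rfl⟩
    obtain ⟨t₀, ht₀⟩ := hbij.surjective i
    rw [SetLike.mem_coe, LinearMap.mem_ker, hD, LinearMap.sub_apply, LinearMap.add_apply,
      diag_map_ιMulti_kunneth, diag_map_ιMulti_kunneth, diag_map_ιMulti_kunneth,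
      diag_update_kunneth_family ω' b i (a + a') c e hbij.injective t₀ ht₀,
      diag_update_kunneth_family ω' b i a c e hbij.injective t₀ ht₀,
      diag_update_kunneth_family ω' b i a' c e hbij.injective t₀ ht₀,
      add_mul, add_smul, AlternatingMap.map_update_add, sub_self]
  have h0 := hker hw
  rw [LinearMap.mem_ker, hD, LinearMap.sub_apply, LinearMap.add_apply] at h0
  exact sub_eq_zero.mp h0

/-- **The coordinate `0` kills the Künneth component**: `⋀^n(A′ (b with 0 at i)) w = 0` for `w` in it
(`AlternatingMap.map_update_zero`). -/
theorem diag_map_update_zero_of_mem_kunneth (n : ℕ) (ω' : Module.Basis ι K V) (b : ι → K) (i : ι)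
    (w : ⋀[F₀]^n V)
    (hw : w ∈ Submodule.span F₀ {w : ⋀[F₀]^n V | ∃ (c : Fin n → K) (e : Fin n → ι), Function.Bijective e ∧
      w = exteriorPower.ιMulti F₀ n (fun t => c t • ω' (e t))}) :
    exteriorPower.map n ((ω'.constr K fun j => Function.update b i (0 : K) j • ω' j).restrictScalars F₀) w = 0 := by
  classical
  have hker : Submodule.span F₀ {w : ⋀[F₀]^n V | ∃ (c : Fin n → K) (e : Fin n → ι), Function.Bijective e ∧
      w = exteriorPower.ιMulti F₀ n (fun t => c t • ω' (e t))} ≤ LinearMap.ker (exteriorPower.map n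
        ((ω'.constr K fun j => Function.update b i (0 : K) j • ω' j).restrictScalars F₀)) := by
    rw [Submodule.span_le]
    rintro _ ⟨c, e, hbij, rfl⟩
    obtain ⟨t₀, ht₀⟩ := hbij.surjective i
    rw [SetLike.mem_coe, LinearMap.mem_ker, diag_map_ιMulti_kunneth,
      diag_update_kunneth_family ω' b i 0 c e hbij.injective t₀ ht₀, zero_mul, zero_smul,
      AlternatingMap.map_update_zero]
  exact LinearMap.mem_ker.mp (hker hw)

/-- **`F₀`-homogeneity in each coordinate**: `⋀^n(A′ (b with r • a at i)) w = r • ⋀^n(A′ (b with a at i)) w` for `r ∈ F₀`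
and `w` in the Künneth component (`AlternatingMap.map_update_smul`: the `F₀`-structure of the wedge is the one `ιMulti F₀`
is multilinear for). -/
theorem diag_map_update_smul_of_mem_kunneth (n : ℕ) (ω' : Module.Basis ι K V) (b : ι → K) (i : ι) (r : F₀) (a : K)
    (w : ⋀[F₀]^n V)
    (hw : w ∈ Submodule.span F₀ {w : ⋀[F₀]^n V | ∃ (c : Fin n → K) (e : Fin n → ι), Function.Bijective e ∧
      w = exteriorPower.ιMulti F₀ n (fun t => c t • ω' (e t))}) :
    exteriorPower.map n ((ω'.constr K fun j => Function.update b i (r • a) j • ω' j).restrictScalars F₀) w =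
      r • exteriorPower.map n ((ω'.constr K fun j => Function.update b i a j • ω' j).restrictScalars F₀) w := by
  classical
  set D : ⋀[F₀]^n V →ₗ[F₀] ⋀[F₀]^n V :=
    exteriorPower.map n ((ω'.constr K fun j => Function.update b i (r • a) j • ω' j).restrictScalars F₀) -
      r • exteriorPower.map n ((ω'.constr K fun j => Function.update b i a j • ω' j).restrictScalars F₀) with hD
  have hker : Submodule.span F₀ {w : ⋀[F₀]^n V | ∃ (c : Fin n → K) (e : Fin n → ι), Function.Bijective e ∧
      w = exteriorPower.ιMulti F₀ n (fun t => c t • ω' (e t))} ≤ LinearMap.ker D := by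
    rw [Submodule.span_le]
    rintro _ ⟨c, e, hbij, rfl⟩
    obtain ⟨t₀, ht₀⟩ := hbij.surjective i
    rw [SetLike.mem_coe, LinearMap.mem_ker, hD, LinearMap.sub_apply, LinearMap.smul_apply,
      diag_map_ιMulti_kunneth, diag_map_ιMulti_kunneth,
      diag_update_kunneth_family ω' b i (r • a) c e hbij.injective t₀ ht₀,
      diag_update_kunneth_family ω' b i a c e hbij.injective t₀ ht₀,
      smul_mul_assoc, smul_assoc, AlternatingMap.map_update_smul, sub_self]
  have h0 := hker hw
  rw [LinearMap.mem_ker, hD, LinearMap.sub_apply, LinearMap.smul_apply] at h0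
  exact sub_eq_zero.mp h0

/-- §4(d)'s `act(a)` is the coordinate `i₀` of the diagonal operators at `b = 1`: the additivity of
`Tier3WeilLineKunneth.weil_act_add_of_mem_kunneth` is the case `b = (fun _ => 1)` of
`diag_map_update_add_of_mem_kunneth` (stated to tie the two files; proved from the latter). -/
theorem weil_act_add_of_mem_kunneth' (n : ℕ) (ω' : Module.Basis ι K V) (i₀ : ι) (a b : K) (w : ⋀[F₀]^n V)
    (hw : w ∈ Submodule.span F₀ {w : ⋀[F₀]^n V | ∃ (c : Fin n → K) (e : Fin n → ι), Function.Bijective e ∧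
      w = exteriorPower.ιMulti F₀ n (fun t => c t • ω' (e t))}) :
    exteriorPower.map n
        ((ω'.constr K fun i => Function.update (fun _ => (1 : K)) i₀ (a + b) i • ω' i).restrictScalars F₀) w =
      exteriorPower.map n
        ((ω'.constr K fun i => Function.update (fun _ => (1 : K)) i₀ a i • ω' i).restrictScalars F₀) w +
      exteriorPower.map n
        ((ω'.constr K fun i => Function.update (fun _ => (1 : K)) i₀ b i • ω' i).restrictScalars F₀) w :=
  diag_map_update_add_of_mem_kunneth n ω' (fun _ => (1 : K)) i₀ a b w hw

end DiagonalOnKunneth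

end HodgeRepro.Tier3
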